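import Mathlib.GroupTheory.Nilpotent
import Mathlib.GroupTheory.Commutator.Basic
import Mathlib.GroupTheory.FreeGroup.Basic
import Mathlib.LinearAlgebra.Finsupp.LinearCombination
import Mathlib.LinearAlgebra.Finsupp.Supported
import Mathlib.Algebra.Module.LinearMap.End
import Mathlib.Data.Set.Finite.List
import Mathlib.Algebra.GroupWithZero.Units.Fintype
import HarnessLib

/-!
# The truncated Magnus representation over a commutative ring: a finite nilpotent target

Topic `Literature/GroupTheory/CombinatorialGroupTheory`; companion of `MagnusResidualNilpotence.lean`
(which works over `ℤ` on ALL words and proves Magnus' theorem `⋂ₙ γₙ(F) = 1`).  Here the same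
stutter-free truncated Magnus representation `x_g ↦ 1 + N_g` (Lyndon–Schupp, *Combinatorial Group
Theory*, Ch. I, Prop. 10.1) is set up over an arbitrary commutative ring `R` on the FREE `R`-MODULE
ON THE WORDS OF LENGTH `< n` only, so that for finite `R` and a finite alphabet the target is a
FINITE group:

* `MagnusTrunc.V R ι n` — finitely supported functions on `{u : List ι // u.length < n}`;
  `MagnusTrunc.F d` — the length filtration; `MagnusTrunc.P k u` — "`u - 1` and `u⁻¹ - 1` raise
  the filtration by `k`"; `P.mul`, `P.inv`, `P.comm` (commutators add degrees);
* `MagnusTrunc.unipotent R ι n` — the subgroup of units `u` with `P 1 u`; it is NILPOTENT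
  (`isNilpotent_unipotent`: the subgroups `P (k+1)` form a descending central series reaching `1`
  at `k = n`) and FINITE when `R` and `ι` are (`finite_unipotent`);
* `MagnusTrunc.rho R n : FreeGroup ι →* (End_R V)ˣ`, `x_g ↦ T_g = 1 + N_g` with `N_g e_u = e_{g u}`
  (if `u` does not start with `g` and `|gu| < n`; else `0`), and its corestriction
  `MagnusTrunc.rhoU : FreeGroup ι →* unipotent R ι n`.

The non-vanishing `ρ(w) ≠ 1` for `|w| < n` (transported from the `ℤ`-version by base change) and
the consequence "free groups are residually {finite nilpotent}" are in
`FreeGroupFiniteNilpotentQuotients.lean`.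

## References

* R. C. Lyndon, P. E. Schupp, *Combinatorial Group Theory*, Springer (1977/2001), Ch. I §10,
  Prop. 10.1 (the Magnus representation) and Prop. 10.2. [LyndonSchupp2001]
* W. Magnus, Beziehungen zwischen Gruppen und Idealen in einem speziellen Ring, Math. Ann. 111
  (1935), 259–280.
-/

noncomputable section

namespace Literature.GroupTheory.CombinatorialGroupTheory

open scoped commutatorElement

namespace MagnusTrunc

section Filtration

variable (R : Type*) [CommRing R] (ι : Type*) (n : ℕ)

/-- The words of length `< n` (the truncation). [cite: LyndonSchupp2001, Ch. I Prop. 10.1] -/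
abbrev W : Type _ := {u : List ι // u.length < n}

/-- The free `R`-module `V = R[W]` on the words of length `< n`. [cite: LyndonSchupp2001, Ch. I Prop. 10.1] -/
abbrev V : Type _ := W ι n →₀ R

variable {R ι n}

/-- `F d`: vectors supported on words of length `≥ d`. [cite: LyndonSchupp2001, Ch. I Prop. 10.2] -/
def F (d : ℕ) : Submodule R (V R ι n) := Finsupp.supported R R {u : W ι n | d ≤ u.1.length}

/-- The filtration is decreasing. [cite: LyndonSchupp2001, Ch. I Prop. 10.2] -/
theorem F_antitone {d d' : ℕ} (h : d ≤ d') : F (R := R) (ι := ι) (n := n) d' ≤ F d :=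
  Finsupp.supported_mono fun _ hu => le_trans h hu

/-- `F 0` is everything. [cite: LyndonSchupp2001, Ch. I Prop. 10.2] -/
theorem mem_F_zero (x : V R ι n) : x ∈ F 0 :=
  (Finsupp.mem_supported' _ _).2 fun _ hu => (hu (Nat.zero_le _)).elim

/-- `F d = 0` for `d ≥ n`: no truncated word has length `≥ n`. [cite: LyndonSchupp2001, Ch. I Prop. 10.2] -/
theorem eq_zero_of_mem_F {d : ℕ} (h : n ≤ d) {x : V R ι n} (hx : x ∈ F d) : x = 0 := by
  ext u
  exact (Finsupp.mem_supported' _ _).1 hx u fun hu => absurd (lt_of_lt_of_le u.2 (h.trans hu)) (lt_irrefl _)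

variable (n) in
/-- `P k u`: `u - 1` and `u⁻¹ - 1` raise the length filtration by `k`. [cite: LyndonSchupp2001, Ch. I Prop. 10.2] -/
def P (k : ℕ) (u : (Module.End R (V R ι n))ˣ) : Prop :=
  ∀ d : ℕ, ∀ x ∈ F (R := R) (ι := ι) (n := n) d,
    ((u : Module.End R (V R ι n)) x - x) ∈ F (R := R) (ι := ι) (n := n) (d + k) ∧
    (((u⁻¹ : (Module.End R (V R ι n))ˣ) : Module.End R (V R ι n)) x - x) ∈
      F (R := R) (ι := ι) (n := n) (d + k)

/-- A `P`-operator preserves each `F d`. [cite: LyndonSchupp2001, Ch. I Prop. 10.2] -/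
theorem P.apply_mem {k : ℕ} {u : (Module.End R (V R ι n))ˣ} (h : P n k u) {d : ℕ} {x : V R ι n}
    (hx : x ∈ F d) : (u : Module.End R (V R ι n)) x ∈ F d := by
  have e : (u : Module.End R (V R ι n)) x = ((u : Module.End R (V R ι n)) x - x) + x := by abel
  rw [e]
  exact add_mem (F_antitone (Nat.le_add_right d k) (h d x hx).1) hx

/-- `P k 1`. [cite: LyndonSchupp2001, Ch. I Prop. 10.2] -/
theorem P_one (k : ℕ) : P n k (1 : (Module.End R (V R ι n))ˣ) := fun d x _ => by
  simp only [inv_one, Units.val_one, Module.End.one_apply, sub_self]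
  exact ⟨zero_mem _, zero_mem _⟩

/-- `P k` is closed under inverses. [cite: LyndonSchupp2001, Ch. I Prop. 10.2] -/
theorem P.inv {k : ℕ} {u : (Module.End R (V R ι n))ˣ} (h : P n k u) : P n k u⁻¹ := fun d x hx => by
  rw [inv_inv]
  exact ⟨(h d x hx).2, (h d x hx).1⟩

/-- `P` is monotone in the degree: `P k u → P k' u` for `k' ≤ k`. [cite: LyndonSchupp2001, Ch. I Prop. 10.2] -/
theorem P.mono {k k' : ℕ} {u : (Module.End R (V R ι n))ˣ} (h : P n k u) (hk : k' ≤ k) : P n k' u :=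
  fun d x hx => ⟨F_antitone (by omega) (h d x hx).1, F_antitone (by omega) (h d x hx).2⟩

/-- `P k` is closed under products: `uv - 1 = (u-1)v + (v-1)`. [cite: LyndonSchupp2001, Ch. I Prop. 10.2] -/
theorem P.mul {k : ℕ} {u v : (Module.End R (V R ι n))ˣ} (hu : P n k u) (hv : P n k v) :
    P n k (u * v) := by
  intro d x hx
  constructor
  · have hvx : (v : Module.End R (V R ι n)) x ∈ F d := hv.apply_mem hx
    have e : ((u * v : (Module.End R (V R ι n))ˣ) : Module.End R (V R ι n)) x - x =
        ((u : Module.End R (V R ι n)) ((v : Module.End R (V R ι n)) x) -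
          (v : Module.End R (V R ι n)) x) + ((v : Module.End R (V R ι n)) x - x) := by
      rw [Units.val_mul, Module.End.mul_apply]; abel
    rw [e]
    exact add_mem (hu d _ hvx).1 (hv d x hx).1
  · have hux : ((u⁻¹ : (Module.End R (V R ι n))ˣ) : Module.End R (V R ι n)) x ∈ F d :=
      hu.inv.apply_mem hx
    have e : (((u * v)⁻¹ : (Module.End R (V R ι n))ˣ) : Module.End R (V R ι n)) x - x =
        (((v⁻¹ : (Module.End R (V R ι n))ˣ) : Module.End R (V R ι n))
            (((u⁻¹ : (Module.End R (V R ι n))ˣ) : Module.End R (V R ι n)) x) -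
          ((u⁻¹ : (Module.End R (V R ι n))ˣ) : Module.End R (V R ι n)) x) +
        ((((u⁻¹ : (Module.End R (V R ι n))ˣ) : Module.End R (V R ι n)) x) - x) := by
      rw [mul_inv_rev, Units.val_mul, Module.End.mul_apply]; abel
    rw [e]
    exact add_mem (hv.inv d _ hux).1 (hu d x hx).2

/-- `u (u⁻¹ x) = x` for units of `End_R V`. [cite: LyndonSchupp2001, Ch. I Prop. 10.2] -/
theorem val_apply_inv_apply (u : (Module.End R (V R ι n))ˣ) (x : V R ι n) :
    (u : Module.End R (V R ι n)) (((u⁻¹ : (Module.End R (V R ι n))ˣ) : Module.End R (V R ι n)) x) = x := by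
  rw [← Module.End.mul_apply, Units.mul_inv, Module.End.one_apply]

/-- The commutator step: `[u,v] - 1 = ((u-1)(v-1) - (v-1)(u-1)) u⁻¹v⁻¹`. [cite: LyndonSchupp2001, Ch. I Prop. 10.2] -/
theorem P.comm_aux {a b : ℕ} {u v : (Module.End R (V R ι n))ˣ} (hu : P n a u) (hv : P n b v) (d : ℕ)
    (x : V R ι n) (hx : x ∈ F d) :
    ((u * v * u⁻¹ * v⁻¹ : (Module.End R (V R ι n))ˣ) : Module.End R (V R ι n)) x - x ∈ F (d + (a + b)) := by
  set y := ((u⁻¹ : (Module.End R (V R ι n))ˣ) : Module.End R (V R ι n))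
    (((v⁻¹ : (Module.End R (V R ι n))ˣ) : Module.End R (V R ι n)) x) with hy
  have hyF : y ∈ F d := hu.inv.apply_mem (hv.inv.apply_mem hx)
  have hL : ((u * v * u⁻¹ * v⁻¹ : (Module.End R (V R ι n))ˣ) : Module.End R (V R ι n)) x =
      (u : Module.End R (V R ι n)) ((v : Module.End R (V R ι n)) y) := by
    simp only [Units.val_mul, Module.End.mul_apply, hy]
  have hR : x = (v : Module.End R (V R ι n)) ((u : Module.End R (V R ι n)) y) := by
    rw [hy, val_apply_inv_apply, val_apply_inv_apply]
  rw [hL]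
  have e : (u : Module.End R (V R ι n)) ((v : Module.End R (V R ι n)) y) - x =
      ((u : Module.End R (V R ι n)) ((v : Module.End R (V R ι n)) y - y) -
          ((v : Module.End R (V R ι n)) y - y)) -
        ((v : Module.End R (V R ι n)) ((u : Module.End R (V R ι n)) y - y) -
          ((u : Module.End R (V R ι n)) y - y)) := by
    rw [hR]
    simp only [map_sub]; abel
  rw [e]
  refine sub_mem ?_ ?_
  · have h1 : (v : Module.End R (V R ι n)) y - y ∈ F (d + b) := (hv d y hyF).1
    have h2 := (hu (d + b) _ h1).1
    rwa [add_assoc, add_comm b a] at h2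
  · have h1 : (u : Module.End R (V R ι n)) y - y ∈ F (d + a) := (hu d y hyF).1
    have h2 := (hv (d + a) _ h1).1
    rwa [add_assoc] at h2

/-- **Commutators raise the filtration degree additively**: `P a u → P b v → P (a+b) [u,v]`.
[cite: LyndonSchupp2001, Ch. I Prop. 10.2] -/
theorem P.comm {a b : ℕ} {u v : (Module.End R (V R ι n))ˣ} (hu : P n a u) (hv : P n b v) :
    P n (a + b) ⁅u, v⁆ := by
  intro d x hx
  refine ⟨?_, ?_⟩
  · rw [commutatorElement_def]
    exact hu.comm_aux hv d x hx
  · rw [commutatorElement_inv, commutatorElement_def, add_comm a b]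
    exact hv.comm_aux hu d x hx

/-- `P k u` with `k ≥ n` forces `u = 1`. [cite: LyndonSchupp2001, Ch. I Prop. 10.2] -/
theorem eq_one_of_P {k : ℕ} (hk : n ≤ k) {u : (Module.End R (V R ι n))ˣ} (h : P n k u) : u = 1 := by
  apply Units.ext
  refine LinearMap.ext fun x => ?_
  have h1 := (h 0 x (mem_F_zero x)).1
  rw [zero_add] at h1
  have h2 := eq_zero_of_mem_F (R := R) (ι := ι) hk h1
  rw [Units.val_one, Module.End.one_apply]
  exact sub_eq_zero.mp h2

/-! ## The unipotent group of the filtration: nilpotent, and finite for finite `R`, `ι` -/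

variable (R ι n) in
/-- The group of units `u` of `End_R V` such that `u - 1`, `u⁻¹ - 1` raise the length filtration.
[cite: LyndonSchupp2001, Ch. I Prop. 10.2] -/
def unipotent : Subgroup (Module.End R (V R ι n))ˣ where
  carrier := {u | P n 1 u}
  one_mem' := P_one 1
  mul_mem' := fun hu hv => hu.mul hv
  inv_mem' := fun hu => hu.inv

/-- Membership in `unipotent`. [cite: LyndonSchupp2001, Ch. I Prop. 10.2] -/
theorem mem_unipotent_iff (u : (Module.End R (V R ι n))ˣ) : u ∈ unipotent R ι n ↔ P n 1 u := Iff.rfl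

variable (R ι n) in
/-- The terms of the descending central series of `unipotent`: `P (k+1)`. [cite: LyndonSchupp2001, Ch. I Prop. 10.2] -/
def unipotentSeries (k : ℕ) : Subgroup (unipotent R ι n) where
  carrier := {q | P n (k + 1) (q : (Module.End R (V R ι n))ˣ)}
  one_mem' := P_one (k + 1)
  mul_mem' := fun hu hv => hu.mul hv
  inv_mem' := fun hu => hu.inv

/-- `P (k+1)` is a descending central series of `unipotent` …. [cite: LyndonSchupp2001, Ch. I Prop. 10.2] -/
theorem isDescendingCentralSeries_unipotentSeries :
    Subgroup.IsDescendingCentralSeries (unipotentSeries R ι n) := by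
  refine ⟨?_, fun x k hx g => ?_⟩
  · exact eq_top_iff.mpr fun q _ => q.2
  · change P n (k + 1 + 1) ((x * g * x⁻¹ * g⁻¹ : unipotent R ι n) : (Module.End R (V R ι n))ˣ)
    have h := P.comm hx g.2
    rw [commutatorElement_def] at h
    simpa using h

/-- … reaching `1` at step `n`. [cite: LyndonSchupp2001, Ch. I Prop. 10.2] -/
theorem unipotentSeries_eq_bot : unipotentSeries R ι n n = ⊥ := by
  rw [eq_bot_iff]
  intro q hq
  rw [Subgroup.mem_bot]
  exact Subtype.ext (eq_one_of_P (Nat.le_succ n) hq)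

/-- **The unipotent group of the length filtration is nilpotent** (of class `≤ n`).
[cite: LyndonSchupp2001, Ch. I Prop. 10.2] -/
theorem isNilpotent_unipotent : Group.IsNilpotent (unipotent R ι n) :=
  (Subgroup.nilpotent_iff_finite_descending_central_series _).mpr
    ⟨n, unipotentSeries R ι n, isDescendingCentralSeries_unipotentSeries, unipotentSeries_eq_bot⟩

/-- For finite `R` and a finite alphabet, the truncated module has finitely many endomorphisms, so
`unipotent` is a finite group. [cite: LyndonSchupp2001, Ch. I Prop. 10.1] -/
theorem finite_unipotent [Finite R] [Finite ι] : Finite (unipotent R ι n) := by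
  haveI : Finite (W ι n) := (List.finite_length_lt ι n).to_subtype
  haveI : Finite (V R ι n) := Finite.of_equiv _ (Finsupp.equivFunOnFinite).symm
  haveI : Finite (Module.End R (V R ι n)) :=
    Finite.of_injective (fun f : Module.End R (V R ι n) => (f : V R ι n → V R ι n))
      (fun f g h => LinearMap.ext fun x => congrFun h x)
  infer_instance

end Filtration

/-! ## The truncated Magnus representation -/

section Representation

variable (R : Type*) [CommRing R] {ι : Type*} [DecidableEq ι] (n : ℕ)

/-- `N_g` on basis vectors: `e_u ↦ e_{g :: u}` if `u` does not start with `g` and `|u| + 1 < n`,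
else `0`. [cite: LyndonSchupp2001, Ch. I Prop. 10.1] -/
def shiftFun (g : ι) (u : W ι n) : V R ι n :=
  if h : u.1.head? ≠ some g ∧ u.1.length + 1 < n then
    Finsupp.single ⟨g :: u.1, by simpa using h.2⟩ 1 else 0

/-- The operator `N_g : V → V` (linear extension of `shiftFun`). [cite: LyndonSchupp2001, Ch. I Prop. 10.1] -/
def shift (g : ι) : Module.End R (V R ι n) := Finsupp.linearCombination R (shiftFun R n g)

/-- `N_g` on a basis vector. [cite: LyndonSchupp2001, Ch. I Prop. 10.1] -/
theorem shift_single (g : ι) (u : W ι n) (c : R) :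
    shift R n g (Finsupp.single u c) = c • shiftFun R n g u := by
  simp [shift, Finsupp.linearCombination_single]

/-- `N_g (N_g e_u) = 0`: the word `g :: u` starts with `g`. [cite: LyndonSchupp2001, Ch. I Prop. 10.1] -/
theorem shift_shiftFun (g : ι) (u : W ι n) : shift R n g (shiftFun R n g u) = 0 := by
  unfold shiftFun
  split_ifs with h
  · rw [shift_single, one_smul, shiftFun, dif_neg]
    simp
  · simp

/-- `N_g² = 0`. [cite: LyndonSchupp2001, Ch. I Prop. 10.1] -/
theorem shift_mul_shift (g : ι) : shift R n g * shift R n g = 0 := by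
  refine Finsupp.lhom_ext fun u c => ?_
  rw [Module.End.mul_apply, shift_single, map_smul, shift_shiftFun, smul_zero, LinearMap.zero_apply]

/-- `T_g = 1 + N_g`, a unit of `End_R V` with inverse `1 - N_g`. [cite: LyndonSchupp2001, Ch. I Prop. 10.1] -/
def T (g : ι) : (Module.End R (V R ι n))ˣ where
  val := 1 + shift R n g
  inv := 1 - shift R n g
  val_inv := by
    refine LinearMap.ext fun x => ?_
    have h2 : shift R n g (shift R n g x) = 0 := by
      simpa using LinearMap.congr_fun (shift_mul_shift R n g) x
    simp only [Module.End.mul_apply, LinearMap.add_apply, LinearMap.sub_apply, Module.End.one_apply,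
      map_sub, h2]
    abel
  inv_val := by
    refine LinearMap.ext fun x => ?_
    have h2 : shift R n g (shift R n g x) = 0 := by
      simpa using LinearMap.congr_fun (shift_mul_shift R n g) x
    simp only [Module.End.mul_apply, LinearMap.add_apply, LinearMap.sub_apply, Module.End.one_apply,
      map_add, h2]
    abel

/-- The truncated Magnus representation `ρ : F(ι) → (End_R V)ˣ`, `x_g ↦ T_g`.
[cite: LyndonSchupp2001, Ch. I Prop. 10.1] -/
def rho : FreeGroup ι →* (Module.End R (V R ι n))ˣ := FreeGroup.lift (T R n)

/-- `ρ` on a generator. [cite: LyndonSchupp2001, Ch. I Prop. 10.1] -/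
theorem rho_of (g : ι) : rho R n (FreeGroup.of g) = T R n g := FreeGroup.lift_apply_of

/-- `N_g` maps `F d` into `F (d+1)`. [cite: LyndonSchupp2001, Ch. I Prop. 10.2] -/
theorem shift_mem_F (g : ι) {d : ℕ} {x : V R ι n} (hx : x ∈ F d) : shift R n g x ∈ F (d + 1) := by
  rw [shift, Finsupp.linearCombination_apply]
  refine Submodule.sum_mem _ fun u hu => Submodule.smul_mem _ _ ?_
  have hu' : d ≤ u.1.length := (Finsupp.mem_supported _ x).1 hx hu
  unfold shiftFun
  split_ifs with h
  · exact Finsupp.single_mem_supported R 1 (by simp only [Set.mem_setOf_eq, List.length_cons]; omega)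
  · exact zero_mem _

/-- Generators act unipotently: `P 1 (T g)`. [cite: LyndonSchupp2001, Ch. I Prop. 10.2] -/
theorem P_T (g : ι) : P n 1 (T R n g) := by
  intro d x hx
  constructor
  · show (1 + shift R n g) x - x ∈ _
    rw [LinearMap.add_apply, Module.End.one_apply, add_sub_cancel_left]
    exact shift_mem_F R n g hx
  · show (1 - shift R n g) x - x ∈ _
    rw [LinearMap.sub_apply, Module.End.one_apply, sub_sub_cancel_left]
    exact neg_mem (shift_mem_F R n g hx)

/-- Every element of the free group acts unipotently: `ρ(w) ∈ unipotent`. [cite: LyndonSchupp2001, Ch. I Prop. 10.2] -/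
theorem rho_mem_unipotent (w : FreeGroup ι) : rho R n w ∈ unipotent R ι n := by
  induction w using FreeGroup.induction_on with
  | C1 => rw [map_one]; exact (unipotent R ι n).one_mem
  | of g => rw [rho_of]; exact P_T R n g
  | inv_of g _ => rw [map_inv, rho_of]; exact (P_T R n g).inv
  | mul x y hx hy => rw [map_mul]; exact (unipotent R ι n).mul_mem hx hy

/-- The truncated Magnus representation corestricted to the (nilpotent) unipotent group.
[cite: LyndonSchupp2001, Ch. I Prop. 10.1] -/
def rhoU : FreeGroup ι →* unipotent R ι n := (rho R n).codRestrict _ (rho_mem_unipotent R n)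

/-- `rhoU` is `rho` on the nose. [cite: LyndonSchupp2001, Ch. I Prop. 10.1] -/
theorem coe_rhoU (w : FreeGroup ι) : (rhoU R n w : (Module.End R (V R ι n))ˣ) = rho R n w := rfl

end Representation

end MagnusTrunc

end Literature.GroupTheory.CombinatorialGroupTheory

end
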